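import Summits.QuantumAdvantage.AdviceFreeQNC0.ProductGame
import Summits.QuantumAdvantage.AdviceFreeQNC0.PLDAMSLadder
import Summits.QuantumAdvantage.AdviceFreeQNC0.EliminationLogDegree
import Summits.QuantumAdvantage.AdviceFreeQNC0.CrossTeam
import HarnessLib

/-!
# Cell qa-qnc0 (rung F-Q1, route RingFrame, crux α, line `product`): stub_LDMA after PLDAMS —
# the transfer from LOW-DEGREE ERROR PATTERNS (`LDRAgg`) to weighted residue non-avoidance (`LDMA`)

Planner qa-qnc0-p1's post-PLDAMS cut of the one open stub `stub_LDMA : LDMAPolylog` of line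
`product` (TARGET §20.3, `Sketch8.lean`, skeleton `line/line-product2.lean`; asks P4(a)(b)(c)):

* vocabulary VERBATIM from `Sketch8` / `line-product2.lean`: `cls`, `bwt`, `LDMAWith κ`
  (= the body of `hL` of `productHard_of_ldma_of_elimHard` with the constant exposed),
  `PLDAMSBool κ₀ D'` (proportional residue non-avoidance for Boolean functions of degree `≤ D' n`),
  `LDRAgg K D'` (low-degree error patterns, class-aggregate);
* **P4(a) `pldamsBool_sqrt`** (= `stub_pldams` of line product2, verbatim signature):
  `∃ κ₀ > 0, ∃ c > 0, PLDAMSBool κ₀ (fun n => ⌊c * √n⌋₊)` — qn-lit's `pldamsSqrt` in Boolean dress;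
* **P4(b) `ldmaWith_of_pldams_of_ldrAgg`** (= `stub_transfer`, = `Sketch8.LDMAofLDR`, verbatim):
  `PLDAMSBool κ₀ D' → LDRAgg K D' → LDMAWith (κ₀ / K)` — three lines of linearity: the class-`r`
  weight of the error pattern `E` is a sum over its COLUMNS, PLDAMS bounds each column's class-`r`
  count below by `κ₀` × its support, the total weight of `E` is `Σ_u hdist(Γ u, F_u) ≥ Σ_u distFail`;
  hence `ldmaPolylog_of_ldrAgg`: `LDRAgg K ⌊c√·⌋₊` for every `c > 0` gives `∃ κ > 0, LDMAWith κ`,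
  i.e. the registered `LDMAPolylog` (so line product2 = `stub_ldr` alone);
* **P4(c), fixed patterns**: `fixedPattern_core` — for every column-degree-`D` map `Γ`
  (`D ≤ D' L`), class `r` and row `u'`,
  `κ₀ · Σ_u distFail(Γ u) ≤ Σ_{u ≡ r} hdist(Γ u, Γ u') + #cls(r) · distFail(Γ u')`
  (ONE fixed nearest fail pattern `F*` of the row `u'` used as the error pattern `Γ ⊕ F*`, column
  degree `D`); corollaries `fixedPatternBound_of_le_avg` (Sketch8's `FixedPatternBound` shape with
  factor `1` for every `u'` whose cost is at most the class-`r` average, e.g. the cheapest class-`r`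
  row) and `fixedPatternBound_two` (every `u'`, factor `2` on the spread term: the triangle
  inequality enters twice).  REMARK for the planner: Sketch8's `FixedPatternBound` as typed (every
  `u'`, factor `1`) does NOT follow from the one-pattern transfer; what the transfer gives is
  `fixedPattern_core`.

WHAT THIS IS NOT: `LDRAgg` (stub_ldr) is open; nothing here touches α / `RingHard 2`; no separation.
-/

noncomputable section

namespace Summit.QuantumAdvantage.AdviceFreeQNC0

open Finset
open Literature.Computability.MetaComplexity Literature.Computability.MetaComplexity.Smolensky

/-! ### Vocabulary (verbatim from `Sketch8` / `line-product2.lean`) -/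

/-- The class-`r` rows of `{0,1}^L`. -/
def cls (L r : ℕ) : Finset (Fin L → Bool) := univ.filter fun u : Fin L → Bool => wt u % 3 = r % 3

/-- Weight of a Boolean row. -/
def bwt {L' : ℕ} (z : (Fin L' → Bool) → Bool) : ℕ := (univ.filter fun v : Fin L' → Bool => z v = true).card

/-- **LDMA with constant `κ`** — the body of `hL` of `productHard_of_ldma_of_elimHard`
(= registered `LDMAPolylog` of line `product` with `κ` exposed: `LDMAPolylog ⟺ ∃ κ > 0, LDMAWith κ`). -/
def LDMAWith (κ : ℝ) : Prop :=
  ∀ C : ℕ, ∃ L₀ : ℕ, ∀ L L' : ℕ, L₀ ≤ L → L₀ ≤ L' → ∀ D : ℕ, D ≤ (Nat.log 2 (min L L')) ^ C →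
    ∀ Γ : (Fin L → Bool) → (Fin L' → Bool) → Bool, (∀ v, HasDeg (fun u => Γ u v) D) → ∀ r : ℕ,
      κ * ((∑ u : Fin L → Bool, distFail D (Γ u) : ℕ) : ℝ) ≤
        ((∑ u ∈ univ.filter (fun u : Fin L → Bool => wt u % 3 = r % 3), distFail D (Γ u) : ℕ) : ℝ)

/-- **PLDAMS in Boolean dress** at degree profile `D'`: every Boolean `f` with `HasDeg f (D' n)` has
at least a `κ₀`-fraction of its support in every class mod `3` (`n ≥ n₀`). -/
def PLDAMSBool (κ₀ : ℝ) (D' : ℕ → ℕ) : Prop :=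
  ∃ n₀ : ℕ, ∀ n : ℕ, n₀ ≤ n → ∀ f : (Fin n → Bool) → Bool, HasDeg f (D' n) → ∀ r : ℕ,
    κ₀ * ((univ.filter fun u : Fin n → Bool => f u = true).card : ℝ) ≤
      ((univ.filter fun u : Fin n → Bool => f u = true ∧ wt u % 3 = r % 3).card : ℝ)

/-- **`LDRAgg K D'` — low-degree error patterns, class-aggregate** (planner qa-qnc0-p1 TARGET §20,
the load-bearing `stub_ldr` of line product2; OPEN): for every column-degree-`D` map `Γ`
(`D ≤ (log₂ min(L,L'))^C`, `L, L' ≥ L₀(C)`) and every class `r` there is an error pattern `E` with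
columns of degree `≤ D' L`, every row `E u = Γ u ⊕ F_u` for some fail pattern `F_u ∈ 𝓕_{L'}(D)`,
and class-`r` weight at most `K` times the class-`r` potential cost. -/
def LDRAgg (K : ℝ) (D' : ℕ → ℕ) : Prop :=
  ∀ C : ℕ, ∃ L₀ : ℕ, ∀ L L' : ℕ, L₀ ≤ L → L₀ ≤ L' → ∀ D : ℕ, D ≤ (Nat.log 2 (min L L')) ^ C →
    ∀ Γ : (Fin L → Bool) → (Fin L' → Bool) → Bool, (∀ v, HasDeg (fun u => Γ u v) D) → ∀ r : ℕ,
      ∃ E : (Fin L → Bool) → (Fin L' → Bool) → Bool,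
        (∀ v, HasDeg (fun u => E u v) (D' L)) ∧
        (∀ u, ∃ F : (Fin L' → Bool) → Bool, IsElimFail D F ∧ ∀ v, E u v = xor (Γ u v) (F v)) ∧
        ((∑ u ∈ cls L r, bwt (E u) : ℕ) : ℝ) ≤ K * ((∑ u ∈ cls L r, distFail D (Γ u) : ℕ) : ℝ)

/-! ### P4(a): PLDAMS in Boolean dress at degree `⌊c√n⌋` -/

/-- **P4(a) / `stub_pldams`**: PLDAMS for Boolean functions of degree `≤ ⌊c√n⌋₊`, from qn-lit's
`pldamsSqrt` (the indicator `[f]` has the same support as `f`). -/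
theorem pldamsBool_sqrt :
    ∃ κ₀ : ℝ, 0 < κ₀ ∧ ∃ c : ℝ, 0 < c ∧ PLDAMSBool κ₀ (fun n => ⌊c * Real.sqrt n⌋₊) := by
  obtain ⟨c, hc, κ₀, hκ₀, n₀, h⟩ := pldamsSqrt
  refine ⟨κ₀, hκ₀, c, hc, n₀, fun n hn f hf r => ?_⟩
  have hd : ((⌊c * Real.sqrt n⌋₊ : ℕ) : ℝ) ≤ c * Real.sqrt n := Nat.floor_le (by positivity)
  have key := h n hn _ hd (fun x => if f x = true then (1 : ZMod 2) else 0) hf r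
  have e1 : (univ.filter fun u : Fin n → Bool => (if f u = true then (1 : ZMod 2) else 0) ≠ 0) =
      univ.filter fun u : Fin n → Bool => f u = true := by
    refine Finset.filter_congr fun u _ => ?_
    cases f u <;> simp
  have e2 : (univ.filter fun u : Fin n → Bool =>
      (if f u = true then (1 : ZMod 2) else 0) ≠ 0 ∧ Hegedus.wt u % 3 = r % 3) =
      univ.filter fun u : Fin n → Bool => f u = true ∧ wt u % 3 = r % 3 := by
    refine Finset.filter_congr fun u _ => ?_
    have hw : Hegedus.wt u = wt u := rfl
    rw [hw]
    cases f u <;> simp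
  rw [e1, e2] at key
  exact key

/-! ### Bookkeeping: weights of error patterns, double counting, the Hamming triangle inequality -/

/-- Constant Boolean functions have degree `0` (hence `≤ d`). -/
theorem hasDeg_const {L : ℕ} (b : Bool) (d : ℕ) : HasDeg (fun _ : Fin L → Bool => b) d := by
  cases b
  · exact hasDeg_false (k := L) d
  · unfold HasDeg
    have : (fun _ : Fin L → Bool => if true = true then (1 : ZMod 2) else 0) = 1 := by
      funext x; simp
    rw [this]
    exact one_mem_lowDeg d

/-- The weight of `z ⊕ F` is the Hamming distance of `z` and `F`. -/
theorem bwt_eq_hdist_of_xor {L' : ℕ} {E z F : (Fin L' → Bool) → Bool}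
    (h : ∀ v, E v = xor (z v) (F v)) : bwt E = hdist z F := by
  unfold bwt hdist
  congr 1
  refine Finset.filter_congr fun v _ => ?_
  rw [h v]
  cases z v <;> cases F v <;> simp

/-- Double counting: the total weight of the rows `u ∈ S` of `E` is the sum over the columns `v` of
the number of rows `u ∈ S` with `E u v = 1`. -/
theorem sum_bwt_eq_sum_card {L L' : ℕ} (S : Finset (Fin L → Bool))
    (E : (Fin L → Bool) → (Fin L' → Bool) → Bool) :
    ∑ u ∈ S, bwt (E u) = ∑ v : Fin L' → Bool, (S.filter fun u => E u v = true).card := by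
  unfold bwt
  simp_rw [Finset.card_filter]
  exact Finset.sum_comm

/-- Symmetry of the Hamming distance. -/
theorem hdist_comm {L' : ℕ} (z w : (Fin L' → Bool) → Bool) : hdist z w = hdist w z := by
  unfold hdist
  congr 1
  exact Finset.filter_congr fun v _ => ne_comm

/-- Triangle inequality for the Hamming distance. -/
theorem hdist_triangle {L' : ℕ} (z w F : (Fin L' → Bool) → Bool) :
    hdist z F ≤ hdist z w + hdist w F := by
  unfold hdist
  refine le_trans (Finset.card_le_card ?_) (Finset.card_union_le _ _)
  intro v hv
  simp only [Finset.mem_filter, Finset.mem_univ, true_and, Finset.mem_union] at hv ⊢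
  by_cases h1 : z v = w v
  · right
    rwa [← h1]
  · left
    exact h1

/-- Triangle inequality for the potential cost: `distFail(z) ≤ hdist(z, w) + distFail(w)`. -/
theorem distFail_le_hdist_add {L' : ℕ} (D : ℕ) (z w : (Fin L' → Bool) → Bool) :
    distFail D z ≤ hdist z w + distFail D w := by
  obtain ⟨F, hF, hFw⟩ := exists_distFail_eq D w
  calc distFail D z ≤ hdist z F := distFail_le z hF
    _ ≤ hdist z w + hdist w F := hdist_triangle z w F
    _ = hdist z w + distFail D w := by rw [hFw]

/-- The total weight of an error pattern `E = Γ ⊕ F` (rows `F_u` fail patterns) is at least the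
total potential cost `Σ_u distFail(Γ u)`. -/
theorem sum_distFail_le_sum_bwt {L L' : ℕ} (D : ℕ) (S : Finset (Fin L → Bool))
    (Γ E : (Fin L → Bool) → (Fin L' → Bool) → Bool)
    (hE : ∀ u, ∃ F : (Fin L' → Bool) → Bool, IsElimFail D F ∧ ∀ v, E u v = xor (Γ u v) (F v)) :
    ∑ u ∈ S, distFail D (Γ u) ≤ ∑ u ∈ S, bwt (E u) := by
  refine Finset.sum_le_sum fun u _ => ?_
  obtain ⟨F, hF, hEu⟩ := hE u
  rw [bwt_eq_hdist_of_xor hEu]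
  exact distFail_le _ hF

/-- PLDAMS summed over the columns of a column-degree-`≤ D' L` pattern `E`: the class-`r` weight of
`E` is at least `κ₀` times its total weight. -/
theorem pldams_columns {κ₀ : ℝ} {L L' d : ℕ}
    (hP : ∀ f : (Fin L → Bool) → Bool, HasDeg f d → ∀ r : ℕ,
      κ₀ * ((univ.filter fun u : Fin L → Bool => f u = true).card : ℝ) ≤
        ((univ.filter fun u : Fin L → Bool => f u = true ∧ wt u % 3 = r % 3).card : ℝ))
    (E : (Fin L → Bool) → (Fin L' → Bool) → Bool) (hEdeg : ∀ v, HasDeg (fun u => E u v) d) (r : ℕ) :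
    κ₀ * ((∑ u : Fin L → Bool, bwt (E u) : ℕ) : ℝ) ≤ ((∑ u ∈ cls L r, bwt (E u) : ℕ) : ℝ) := by
  rw [sum_bwt_eq_sum_card univ E, sum_bwt_eq_sum_card (cls L r) E]
  push_cast
  rw [Finset.mul_sum]
  refine Finset.sum_le_sum fun v _ => ?_
  have h1 := hP (fun u => E u v) (hEdeg v) r
  have e1 : (univ.filter fun u : Fin L → Bool => E u v = true ∧ wt u % 3 = r % 3) =
      (cls L r).filter fun u => E u v = true := by
    unfold cls
    rw [Finset.filter_filter]
    exact Finset.filter_congr fun u _ => and_comm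
  have e2 : (univ.filter fun u : Fin L → Bool => E u v = true) =
      (univ : Finset (Fin L → Bool)).filter fun u => E u v = true := rfl
  rw [e1] at h1
  exact h1

/-! ### P4(b): the transfer `PLDAMS ∧ LDRAgg ⟹ LDMA` -/

/-- **P4(b) / `stub_transfer` / `Sketch8.LDMAofLDR`: PLDAMS at degree profile `D'` and low-degree
error patterns `LDRAgg K D'` give LDMA with constant `κ₀ / K`.**  Proof:
`K·Σ_{u≡r} distFail ≥ Σ_{u≡r} wt(E u) = Σ_v #{u ≡ r : E u v} ≥ κ₀·Σ_v #{u : E u v} = κ₀·Σ_u wt(E u)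
≥ κ₀·Σ_u distFail` (`wt(E u) = hdist(Γ u, F_u) ≥ distFail`). -/
theorem ldmaWith_of_pldams_of_ldrAgg :
    ∀ (κ₀ K : ℝ) (D' : ℕ → ℕ), 0 < K → PLDAMSBool κ₀ D' → LDRAgg K D' → LDMAWith (κ₀ / K) := by
  intro κ₀ K D' hK hP hR C
  obtain ⟨n₀, hP⟩ := hP
  obtain ⟨L₁, hL₁⟩ := hR C
  refine ⟨max L₁ n₀, fun L L' hL hL' D hD Γ hΓ r => ?_⟩
  obtain ⟨E, hEdeg, hErow, hEwt⟩ :=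
    hL₁ L L' (le_trans (le_max_left _ _) hL) (le_trans (le_max_left _ _) hL') D hD Γ hΓ r
  have hB : (0 : ℝ) ≤ ((∑ u ∈ univ.filter (fun u : Fin L → Bool => wt u % 3 = r % 3),
      distFail D (Γ u) : ℕ) : ℝ) := by positivity
  by_cases hκ₀ : 0 ≤ κ₀
  · -- (1) total cost ≤ total weight of `E`
    have h1 : ((∑ u : Fin L → Bool, distFail D (Γ u) : ℕ) : ℝ) ≤
        ((∑ u : Fin L → Bool, bwt (E u) : ℕ) : ℝ) := by
      exact_mod_cast sum_distFail_le_sum_bwt D univ Γ E hErow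
    -- (2) PLDAMS column by column
    have h2 : κ₀ * ((∑ u : Fin L → Bool, bwt (E u) : ℕ) : ℝ) ≤ ((∑ u ∈ cls L r, bwt (E u) : ℕ) : ℝ) :=
      pldams_columns (hP L (le_trans (le_max_right _ _) hL)) E hEdeg r
    -- (3) the class-`r` weight of `E` is at most `K` × the class-`r` cost (LDRAgg)
    have h3 : ((∑ u ∈ cls L r, bwt (E u) : ℕ) : ℝ) ≤
        K * ((∑ u ∈ cls L r, distFail D (Γ u) : ℕ) : ℝ) := hEwt
    have hchain : κ₀ * ((∑ u : Fin L → Bool, distFail D (Γ u) : ℕ) : ℝ) ≤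
        K * ((∑ u ∈ cls L r, distFail D (Γ u) : ℕ) : ℝ) :=
      le_trans (le_trans (mul_le_mul_of_nonneg_left h1 hκ₀) h2) h3
    have : κ₀ / K * ((∑ u : Fin L → Bool, distFail D (Γ u) : ℕ) : ℝ) ≤
        ((∑ u ∈ cls L r, distFail D (Γ u) : ℕ) : ℝ) := by
      rw [div_mul_eq_mul_div, div_le_iff₀ hK, mul_comm _ K]
      exact hchain
    unfold cls at this
    exact this
  · have hκ₀' : κ₀ < 0 := lt_of_not_ge hκ₀
    have : κ₀ / K * ((∑ u : Fin L → Bool, distFail D (Γ u) : ℕ) : ℝ) ≤ 0 :=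
      mul_nonpos_of_nonpos_of_nonneg (div_neg_of_neg_of_pos hκ₀' hK).le (by positivity)
    exact le_trans this hB

/-- **Line product2 after P4(a)(b): `LDRAgg` alone gives the registered `LDMAPolylog`** (in the form
`∃ κ > 0, LDMAWith κ`, syntactically `hL` of `productHard_of_ldma_of_elimHard` /
`ringToElim_of_ldma`): low-degree error patterns with column degree `⌊c√L⌋` for every `c > 0`
suffice. -/
theorem ldmaPolylog_of_ldrAgg
    (h : ∀ c : ℝ, 0 < c → ∃ K : ℝ, 0 < K ∧ LDRAgg K (fun n => ⌊c * Real.sqrt n⌋₊)) :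
    ∃ κ : ℝ, 0 < κ ∧ LDMAWith κ := by
  obtain ⟨κ₀, hκ₀, c, hc, hP⟩ := pldamsBool_sqrt
  obtain ⟨K, hK, hR⟩ := h c hc
  exact ⟨κ₀ / K, div_pos hκ₀ hK, ldmaWith_of_pldams_of_ldrAgg κ₀ K _ hK hP hR⟩

/-! ### P4(c): what ONE fixed fail pattern gives -/

/-- The class `r` has at least `κ₀·2^L` elements under PLDAMS (the constant function `1` has
degree `0`). -/
theorem card_cls_ge_of_pldams {κ₀ : ℝ} {L d : ℕ}
    (hP : ∀ f : (Fin L → Bool) → Bool, HasDeg f d → ∀ r : ℕ,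
      κ₀ * ((univ.filter fun u : Fin L → Bool => f u = true).card : ℝ) ≤
        ((univ.filter fun u : Fin L → Bool => f u = true ∧ wt u % 3 = r % 3).card : ℝ)) (r : ℕ) :
    κ₀ * (2 : ℝ) ^ L ≤ ((cls L r).card : ℝ) := by
  have hdeg : HasDeg (fun _ : Fin L → Bool => true) d := hasDeg_const true d
  have h := hP (fun _ => true) hdeg r
  have e1 : (univ.filter fun _ : Fin L → Bool => true = true) = (univ : Finset (Fin L → Bool)) := by
    simp
  have e2 : (univ.filter fun u : Fin L → Bool => true = true ∧ wt u % 3 = r % 3) = cls L r := by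
    unfold cls
    exact Finset.filter_congr fun u _ => by simp
  rw [e1, e2, Finset.card_univ, Fintype.card_fun, Fintype.card_bool, Fintype.card_fin] at h
  push_cast at h
  exact h

/-- **P4(c), core inequality (ONE fixed pattern).**  For a column-degree-`D` map `Γ` with
`D ≤ D' L`, a class `r` and ANY row `u'`:
`κ₀·Σ_u distFail(Γ u) ≤ Σ_{u ≡ r} hdist(Γ u, Γ u') + #cls(r)·distFail(Γ u')`.
Proof: with `F*` a nearest fail pattern of the row `u'`, the pattern `E u := Γ u ⊕ F*` has columns
of degree `≤ D` (a constant shift), so PLDAMS per column gives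
`Σ_{u≡r} hdist(Γ u, F*) ≥ κ₀ Σ_u hdist(Γ u, F*) ≥ κ₀ Σ_u distFail(Γ u)`, and
`hdist(Γ u, F*) ≤ hdist(Γ u, Γ u') + distFail(Γ u')`. -/
theorem fixedPattern_core (κ₀ : ℝ) (D' : ℕ → ℕ) (hP : PLDAMSBool κ₀ D') :
    ∃ L₀ : ℕ, ∀ L L' D : ℕ, L₀ ≤ L → D ≤ D' L →
      ∀ Γ : (Fin L → Bool) → (Fin L' → Bool) → Bool, (∀ v, HasDeg (fun u => Γ u v) D) →
        ∀ r : ℕ, ∀ u' : Fin L → Bool,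
          κ₀ * ((∑ u : Fin L → Bool, distFail D (Γ u) : ℕ) : ℝ) ≤
            ((∑ u ∈ cls L r, hdist (Γ u) (Γ u') : ℕ) : ℝ) +
              ((cls L r).card : ℝ) * (distFail D (Γ u') : ℝ) := by
  obtain ⟨n₀, hP⟩ := hP
  refine ⟨n₀, fun L L' D hL hD Γ hΓ r u' => ?_⟩
  have hPL := hP L hL
  obtain ⟨F, hF, hFu'⟩ := exists_distFail_eq D (Γ u')
  -- the error pattern `E u = Γ u ⊕ F*`
  set E : (Fin L → Bool) → (Fin L' → Bool) → Bool := fun u v => xor (Γ u v) (F v) with hEdef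
  have hEdeg : ∀ v, HasDeg (fun u => E u v) (D' L) := by
    intro v
    have hc : HasDeg (fun _ : Fin L → Bool => F v) D := hasDeg_const (F v) D
    have hx : HasDeg (fun u => xor (Γ u v) (F v)) D := hasDeg_xor (hΓ v) hc
    exact lowDeg_mono hD hx
  have hEwt : ∀ u, bwt (E u) = hdist (Γ u) F := fun u => bwt_eq_hdist_of_xor fun v => rfl
  have hRHS : (0 : ℝ) ≤ ((∑ u ∈ cls L r, hdist (Γ u) (Γ u') : ℕ) : ℝ) +
      ((cls L r).card : ℝ) * (distFail D (Γ u') : ℝ) := by positivity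
  by_cases hκ₀ : 0 ≤ κ₀
  · -- κ₀ Σ distFail ≤ κ₀ Σ hdist(Γ u, F*) = κ₀ Σ_u bwt (E u)
    have h1 : ((∑ u : Fin L → Bool, distFail D (Γ u) : ℕ) : ℝ) ≤
        ((∑ u : Fin L → Bool, bwt (E u) : ℕ) : ℝ) := by
      have : ∑ u : Fin L → Bool, distFail D (Γ u) ≤ ∑ u : Fin L → Bool, bwt (E u) :=
        Finset.sum_le_sum fun u _ => by rw [hEwt u]; exact distFail_le _ hF
      exact_mod_cast this
    have h2 : κ₀ * ((∑ u : Fin L → Bool, bwt (E u) : ℕ) : ℝ) ≤ ((∑ u ∈ cls L r, bwt (E u) : ℕ) : ℝ) :=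
      pldams_columns hPL E hEdeg r
    -- Σ_{cls} bwt (E u) = Σ_{cls} hdist(Γ u, F*) ≤ Σ_{cls} (hdist(Γ u, Γ u') + distFail(Γ u'))
    have h3 : ∑ u ∈ cls L r, bwt (E u) ≤
        ∑ u ∈ cls L r, hdist (Γ u) (Γ u') + (cls L r).card * distFail D (Γ u') := by
      rw [Finset.card_eq_sum_ones, Finset.sum_mul, one_mul, ← Finset.sum_add_distrib]
      refine Finset.sum_le_sum fun u _ => ?_
      rw [hEwt u, ← hFu']
      exact hdist_triangle _ _ _
    have h3' : ((∑ u ∈ cls L r, bwt (E u) : ℕ) : ℝ) ≤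
        ((∑ u ∈ cls L r, hdist (Γ u) (Γ u') : ℕ) : ℝ) +
          ((cls L r).card : ℝ) * (distFail D (Γ u') : ℝ) := by
      exact_mod_cast h3
    exact le_trans (le_trans (mul_le_mul_of_nonneg_left h1 hκ₀) h2) h3'
  · have hκ₀' : κ₀ < 0 := lt_of_not_ge hκ₀
    exact le_trans (mul_nonpos_of_nonpos_of_nonneg hκ₀'.le (by positivity)) hRHS

/-- **P4(c) for a cheap pivot (Sketch8's `FixedPatternBound` shape, factor `1`):** if the row `u'`
costs at most the class-`r` AVERAGE (`#cls(r)·distFail(Γ u') ≤ Σ_{u≡r} distFail(Γ u)`; e.g. the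
cheapest class-`r` row), then
`κ₀·Σ_u distFail(Γ u) − Σ_{u≡r} hdist(Γ u, Γ u') ≤ Σ_{u≡r} distFail(Γ u)`. -/
theorem fixedPatternBound_of_le_avg (κ₀ : ℝ) (D' : ℕ → ℕ) (hP : PLDAMSBool κ₀ D') :
    ∃ L₀ : ℕ, ∀ L L' D : ℕ, L₀ ≤ L → D ≤ D' L →
      ∀ Γ : (Fin L → Bool) → (Fin L' → Bool) → Bool, (∀ v, HasDeg (fun u => Γ u v) D) →
        ∀ r : ℕ, ∀ u' : Fin L → Bool,
          (cls L r).card * distFail D (Γ u') ≤ ∑ u ∈ cls L r, distFail D (Γ u) →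
          κ₀ * ((∑ u : Fin L → Bool, distFail D (Γ u) : ℕ) : ℝ) -
              ((∑ u ∈ cls L r, hdist (Γ u) (Γ u') : ℕ) : ℝ) ≤
            ((∑ u ∈ cls L r, distFail D (Γ u) : ℕ) : ℝ) := by
  obtain ⟨L₀, h⟩ := fixedPattern_core κ₀ D' hP
  refine ⟨L₀, fun L L' D hL hD Γ hΓ r u' havg => ?_⟩
  have hc := h L L' D hL hD Γ hΓ r u'
  have havg' : ((cls L r).card : ℝ) * (distFail D (Γ u') : ℝ) ≤
      ((∑ u ∈ cls L r, distFail D (Γ u) : ℕ) : ℝ) := by exact_mod_cast havg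
  linarith

/-- **P4(c) for EVERY pivot, factor `2` on the spread term:**
`κ₀·Σ_u distFail(Γ u) − 2·Σ_{u≡r} hdist(Γ u, Γ u') ≤ Σ_{u≡r} distFail(Γ u)` — the core inequality
plus `distFail(Γ u') ≤ hdist(Γ u', Γ u) + distFail(Γ u)` summed over the class-`r` rows (the
triangle inequality enters twice; Sketch8's factor-`1` form for every `u'` is not obtained this way). -/
theorem fixedPatternBound_two (κ₀ : ℝ) (D' : ℕ → ℕ) (hP : PLDAMSBool κ₀ D') :
    ∃ L₀ : ℕ, ∀ L L' D : ℕ, L₀ ≤ L → D ≤ D' L →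
      ∀ Γ : (Fin L → Bool) → (Fin L' → Bool) → Bool, (∀ v, HasDeg (fun u => Γ u v) D) →
        ∀ r : ℕ, ∀ u' : Fin L → Bool,
          κ₀ * ((∑ u : Fin L → Bool, distFail D (Γ u) : ℕ) : ℝ) -
              2 * ((∑ u ∈ cls L r, hdist (Γ u) (Γ u') : ℕ) : ℝ) ≤
            ((∑ u ∈ cls L r, distFail D (Γ u) : ℕ) : ℝ) := by
  obtain ⟨L₀, h⟩ := fixedPattern_core κ₀ D' hP
  refine ⟨L₀, fun L L' D hL hD Γ hΓ r u' => ?_⟩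
  have hc := h L L' D hL hD Γ hΓ r u'
  -- #cls·distFail(Γ u') ≤ Σ_{cls} (hdist(Γ u, Γ u') + distFail(Γ u))
  have ht : (cls L r).card * distFail D (Γ u') ≤
      ∑ u ∈ cls L r, hdist (Γ u) (Γ u') + ∑ u ∈ cls L r, distFail D (Γ u) := by
    rw [Finset.card_eq_sum_ones, Finset.sum_mul, one_mul, ← Finset.sum_add_distrib]
    refine Finset.sum_le_sum fun u _ => ?_
    rw [hdist_comm]
    exact distFail_le_hdist_add D (Γ u') (Γ u)
  have ht' : ((cls L r).card : ℝ) * (distFail D (Γ u') : ℝ) ≤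
      ((∑ u ∈ cls L r, hdist (Γ u) (Γ u') : ℕ) : ℝ) + ((∑ u ∈ cls L r, distFail D (Γ u) : ℕ) : ℝ) := by
    exact_mod_cast ht
  linarith

end Summit.QuantumAdvantage.AdviceFreeQNC0
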